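import Mathlib
import Summits.ResolutionOfSingularities.ResolutionOfSingularities.Theorems.WeightedInvariantLocalWeightedDropNCResCurveGraphIdeal
import Summits.ResolutionOfSingularities.ResolutionOfSingularities.Theorems.WeightedInvariantLocalWeightedDropTOT2NearSettingOld
import Summits.ResolutionOfSingularities.ResolutionOfSingularities.Theorems.WeightedInvariantLocalWeightedDropTOT2NearOld
import Summits.ResolutionOfSingularities.ResolutionOfSingularities.Theorems.WeightedInvariantLocalWeightedDropTOT2E1Decorated
-- SCRATCH-IMPORT: Summits.ResolutionOfSingularities.ResolutionOfSingularities.Theorems.WeightedInvariantLocalWeightedDropTOT2E1Decorated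
-- SCRATCH-IMPORT: Summits.ResolutionOfSingularities.ResolutionOfSingularities.Theorems.WeightedInvariantLocalWeightedDropTOT2NearSettingOld
-- SCRATCH-IMPORT: Summits.ResolutionOfSingularities.ResolutionOfSingularities.Theorems.WeightedInvariantLocalWeightedDropTOT2NearOld

/-!
# `WeightedInvariant.LocalWeightedDrop`: NC-RESOLUTION SETTINGS for the TOT₂ line (S-SET), part 16 — GRAPH CURVES under the identity point move:
# the same-head answer is the tangent answer, the contact potential drops, and apex dimension ≤ 1 persists

Crux item stmt-ResolutionOfSingularities-8899 `LocalWeightedDrop` (route `ResolutionOfSingularities/WeightedInvariant`), ENGINE skeleton v32,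
residual `stub_spaceNCRankDrop`; TOT2-LINE (res-L1-w43-lead-1) inner dispatch, sub-regime S-E1-CURVE (gap note `L/res-L1-w43-stub-1/E1-CURVE-GAP.md`).
[OURS · L1 W4.3 · chain w43 · seat res-L1-w43-stub-1 gen 6; def-free on parts 14–15 and res-L1-w43-stub-3's S-NEAR parts 5/7 (`TOT2Near.near_old`,
`TOT2Near.inv_mul_prod_X_iff`, `TOT2Near.Decoration.apexLineO_transform`); nothing here is a statement of any manuscript; AI-produced, gate-checked,
weaker than expert review.]

For an admissibly decorated position `(b, δ)` with product `g = f·∏_{l∈O} x_l` of order `c = δ.c`, a graph curve `(i, φ)` permissible for `g`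
(`Φ_C^* g ∈ (x_j : j ≠ i)^c`) and apex dimension `≤ 1` (every two invariance vectors of `in_c g` dependent), under the IDENTITY POINT MOVE:
* `newLetters_X` — letter bookkeeping (with res-type-056's `TOT2E1.strIdx_X`) of the identity move (no straightening: the new letters are `predAbove i (succ l)`, `c′_l = 0`).
* **`tangent_answer_of_head_eq`** — an answer `(c′, i′)` at which the head did NOT drop is the TANGENT answer: `c′ = c′_i · tangent` and `c′_i ≠ 0`
  (same head ⇒ `O`-near ⇒ `c′ ∈ Dir(in_c g)` by (N1)-with-history ⇒ a multiple of the tangent by part 15).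
* **`contactSq_step_le`, `contactSq_step_lt`** — at the tangent answer the contact potential of the successor graph datum `step i φ c′` w.r.t. the
  successor's letters `insert 0 (newLetters E X c′ i)` is `≤` the old one, and `<` unless every letter `l ≠ i` already contains the curve
  (transverse letters leave, tangent letters lose one order of contact: `order_stepSeries_add_one`).
* **`apexLine_transform_of_head_eq`** — apex dimension `≤ 1` of the product persists at a same-head answer (stub-3's (N2)-with-history).
-/

set_option linter.dupNamespace false -- mandated namespace of this single-conjunct summit

noncomputable section

namespace Summit.ResolutionOfSingularities.ResolutionOfSingularities.Theorems

namespace TameFourTupleDrop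

namespace GraphCurve

open MvPowerSeries Literature.AlgebraicGeometry.Resolution

variable {k : Type} [Field k] {m : ℕ}

-- BODY-START
/-! ## Letter bookkeeping of the identity move -/

open Classical in
/-- The new letters of the identity move: the through-going letters (`c′_l = 0`), re-indexed by `predAbove i (succ l)`. -/
theorem newLetters_X (S : Finset (Fin (m + 1))) (c' : Fin (m + 1) → k) (i : Fin (m + 1)) :
    Decoration.newLetters S (fun j => (X j : MvPowerSeries (Fin (m + 1)) k)) c' i =
      (S.filter fun l => c' l = 0).image fun l => Fin.predAbove i (Fin.succ l) := by
  unfold Decoration.newLetters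
  simp_rw [TOT2E1.strIdx_X]

/-! ## The head letters of a same-head answer -/

section SameHead

variable {b : MvPowerSeries (Fin (m + 1)) k} {δ : Decoration k m} {c' : Fin (m + 1) → k} {i' : Fin (m + 1)}

/-- Same head ⇒ same order letter. -/
theorem o_transform_eq_of_head_eq {Φ : Fin (m + 1) → MvPowerSeries (Fin (m + 1)) k} {w : Fin (m + 1) → ℕ}
    (hhead : (δ.transform Φ w c' i').head = δ.head) : (δ.transform Φ w c' i').o = δ.o := by
  rw [Decoration.head, Decoration.head, toLex_inj] at hhead
  exact (Prod.ext_iff.mp hhead).1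

/-- Same head ⇒ same `c` letter. -/
theorem c_transform_eq_of_head_eq {Φ : Fin (m + 1) → MvPowerSeries (Fin (m + 1)) k} {w : Fin (m + 1) → ℕ}
    (hhead : (δ.transform Φ w c' i').head = δ.head) : (δ.transform Φ w c' i').c = δ.c := by
  rw [Decoration.head, Decoration.head, toLex_inj] at hhead
  exact (Prod.ext_iff.mp hhead).2

/-- Same head ⇒ same number of old letters. -/
theorem card_O_transform_eq_of_head_eq {Φ : Fin (m + 1) → MvPowerSeries (Fin (m + 1)) k} {w : Fin (m + 1) → ℕ}
    (hhead : (δ.transform Φ w c' i').head = δ.head) : (δ.transform Φ w c' i').O.card = δ.O.card := by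
  have ho := o_transform_eq_of_head_eq hhead
  have hc := c_transform_eq_of_head_eq hhead
  simp only [Decoration.c] at hc
  omega

/-- Same head ⇒ the old letters of the successor are the through-going old letters. -/
theorem O_transform_eq_of_head_eq {Φ : Fin (m + 1) → MvPowerSeries (Fin (m + 1)) k} {w : Fin (m + 1) → ℕ}
    (hhead : (δ.transform Φ w c' i').head = δ.head) : (δ.transform Φ w c' i').O = Decoration.newLetters δ.O Φ c' i' := by
  have ho := o_transform_eq_of_head_eq hhead
  refine Decoration.transform_O_of_not_lt _ _ _ _ _ ?_
  rw [← Decoration.transform_o, ho]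
  exact lt_irrefl _

/-- The order of the equation as the order letter. -/
theorem order_f_eq_o (hadm : Admissible b δ) : δ.f.order = (δ.o : ℕ∞) := by
  rw [Decoration.o, ENat.coe_toNat]
  rw [ne_eq, order_eq_top_iff]; exact hadm.2.1.ne_zero

/-- **SAME HEAD ⇒ `O`-NEAR**: at an answer of a B-permissible move where the head did not drop, the sliced strict transform of the product
`g = f·∏_O x_l` has order (at least) `c`. -/
theorem le_order_slice_of_head_eq {Φ : Fin (m + 1) → MvPowerSeries (Fin (m + 1)) k} {w : Fin (m + 1) → ℕ} (hadm : Admissible b δ)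
    (hperm : IsBPermissible δ Φ w) (hc : ∀ l, w l = 0 → c' l = 0) (hci' : c' i' ≠ 0) {A : ℕ} {G : MvPowerSeries (Fin (m + 1 + 1)) k}
    (hfac : subst (CobordantChart.chart w c') (subst Φ (δ.f * ∏ l ∈ δ.O, X l)) = X 0 ^ A * G) (hG : ¬ X 0 ∣ G)
    (hhead : (δ.transform Φ w c' i').head = δ.head) : (δ.c : ℕ∞) ≤ (TupleGame.slice i' G).order := by
  have hf : δ.f ≠ 0 := hadm.2.1.ne_zero
  obtain ⟨-, hord⟩ := Decoration.order_slice_totalO_eq hperm hc hf hci' hfac hG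
  have ho := o_transform_eq_of_head_eq hhead
  rw [hord, Decoration.order_strict_eq_of_o_transform_eq hperm hc hf hci' ho, order_f_eq_o hadm, ← O_transform_eq_of_head_eq hhead,
    card_O_transform_eq_of_head_eq hhead, ← Nat.cast_add]
  exact le_of_eq rfl

end SameHead

/-! ## The same-head answer of the identity point move at a graph curve is the tangent answer -/

/-- **THE SAME-HEAD ANSWER IS THE TANGENT ANSWER** (OURS · L1 W4.3; S-E1-CURVE).  From an admissibly decorated position with product
`g = f·∏_O x_l` of order `c`, a permissible graph curve `(i, φ)` and apex dimension `≤ 1`: an answer `(c′, i′)` of the identity point move at which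
the head did NOT drop satisfies `c′ = c′_i · tangent` with `c′_i ≠ 0` (so the live slot `i` is available and the successor is read there). -/
theorem tangent_answer_of_head_eq [Infinite k] {b : MvPowerSeries (Fin (m + 1)) k} {δ : Decoration k m} (hadm : Admissible b δ)
    {i : Fin (m + 1)} {φ : Fin (m + 1) → PowerSeries k} (hφ : ∀ j, j ≠ i → PowerSeries.constantCoeff (φ j) = 0)
    (hperm : InOffIdeal i δ.c (subst (shear i φ) (δ.f * ∏ l ∈ δ.O, X l)))
    (hcol : ∀ u₁ u₂ : Fin (m + 1) → k,
      (∀ v, CobordantChart.initEval (fun _ : Fin (m + 1) => 1) (v + u₁) δ.c (δ.f * ∏ l ∈ δ.O, X l) =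
        CobordantChart.initEval (fun _ : Fin (m + 1) => 1) v δ.c (δ.f * ∏ l ∈ δ.O, X l)) →
      (∀ v, CobordantChart.initEval (fun _ : Fin (m + 1) => 1) (v + u₂) δ.c (δ.f * ∏ l ∈ δ.O, X l) =
        CobordantChart.initEval (fun _ : Fin (m + 1) => 1) v δ.c (δ.f * ∏ l ∈ δ.O, X l)) →
      ∃ α β : k, (α ≠ 0 ∨ β ≠ 0) ∧ α • u₁ + β • u₂ = 0)
    {c' : Fin (m + 1) → k} {i' : Fin (m + 1)} (hci' : c' i' ≠ 0) {A : ℕ} {G : MvPowerSeries (Fin (m + 1 + 1)) k}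
    (hfac : subst (CobordantChart.chart (fun _ : Fin (m + 1) => 1) c') (δ.f * ∏ l ∈ δ.O, X l) = X 0 ^ A * G) (hG : ¬ X 0 ∣ G)
    (hhead : (δ.transform (fun j => (X j : MvPowerSeries (Fin (m + 1)) k)) (fun _ => 1) c' i').head = δ.head) :
    c' = c' i • tangent i φ ∧ c' i ≠ 0 := by
  have hf : δ.f ≠ 0 := hadm.2.1.ne_zero
  have hpermX := isBPermissible_point_X δ
  have hconv : ∀ l, (fun _ : Fin (m + 1) => (1 : ℕ)) l = 0 → c' l = 0 := fun _ h => absurd h one_ne_zero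
  have hfacX : subst (CobordantChart.chart (fun _ : Fin (m + 1) => 1) c')
      (subst (fun j => (X j : MvPowerSeries (Fin (m + 1)) k)) (δ.f * ∏ l ∈ δ.O, X l)) = X 0 ^ A * G := by
    rw [show subst (fun j => (X j : MvPowerSeries (Fin (m + 1)) k)) (δ.f * ∏ l ∈ δ.O, X l) = δ.f * ∏ l ∈ δ.O, X l from
      congrFun subst_self _]
    exact hfac
  obtain ⟨hA, -⟩ := Decoration.order_slice_totalO_eq hpermX hconv hf hci' hfacX hG
  subst hA
  have hnear := le_order_slice_of_head_eq hadm hpermX hconv hci' hfacX hG hhead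
  -- (N1) with history: `c′` is an invariance vector of `in_o f` vanishing on the old letters
  have hord : δ.f.order = (δ.o : ℕ∞) := order_f_eq_o hadm
  obtain ⟨hinvf, hzero⟩ := TOT2Near.near_old δ.f hord δ.O c' i' hci' (by exact hfac) (by exact hnear)
  have hinvg : ∀ v, CobordantChart.initEval (fun _ : Fin (m + 1) => 1) (v + c') δ.c (δ.f * ∏ l ∈ δ.O, X l) =
      CobordantChart.initEval (fun _ : Fin (m + 1) => 1) v δ.c (δ.f * ∏ l ∈ δ.O, X l) :=
    (TOT2Near.inv_mul_prod_X_iff hord δ.O c').mpr ⟨fun v => by simpa using hinvf 1 v, hzero⟩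
  have hgc : (δ.f * ∏ l ∈ δ.O, X l).order = (δ.c : ℕ∞) := Decoration.order_totalO hadm
  have hc' : c' = c' i • tangent i φ := eq_smul_tangent_of_inv hφ hgc hperm hcol hinvg
  refine ⟨hc', fun h0 => ?_⟩
  have hz : c' = 0 := by rw [hc', h0, zero_smul]
  exact hci' (by rw [hz]; rfl)

/-- The tangent answer's coordinates: `c′_j = c′_i · φ_j′(0)` for `j ≠ i`. -/
theorem answer_apply_of_eq_smul_tangent {i : Fin (m + 1)} {φ : Fin (m + 1) → PowerSeries k} {c' : Fin (m + 1) → k}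
    (hc' : c' = c' i • tangent i φ) (j : Fin (m + 1)) (hj : j ≠ i) : c' j = c' i * PowerSeries.coeff 1 (φ j) := by
  conv_lhs => rw [hc']
  rw [Pi.smul_apply, tangent_of_ne hj, smul_eq_mul]

/-! ## The contact potential drops at the tangent answer -/

/-- A letter that passes through the tangent answer (`c′_l = 0`, `l ≠ i`) is TANGENT to the curve: `φ_l′(0) = 0`. -/
theorem coeff_one_eq_zero_of_answer_eq_zero {i : Fin (m + 1)} {φ : Fin (m + 1) → PowerSeries k} {c' : Fin (m + 1) → k}
    (hc' : c' = c' i • tangent i φ) (hci : c' i ≠ 0) {l : Fin (m + 1)} (hl : l ≠ i) (h0 : c' l = 0) : PowerSeries.coeff 1 (φ l) = 0 := by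
  have h := answer_apply_of_eq_smul_tangent hc' l hl
  rw [h0] at h
  exact (mul_eq_zero.mp h.symm).resolve_left hci

/-- The squared contact order of a through-going letter drops (weakly; strictly when the letter does not contain the curve). -/
theorem contact_step_le {i : Fin (m + 1)} {φ : Fin (m + 1) → PowerSeries k} (hφ : ∀ j, j ≠ i → PowerSeries.constantCoeff (φ j) = 0)
    {c' : Fin (m + 1) → k} (hci : c' i ≠ 0) {l : Fin (m + 1)} (hl : l ≠ i) (h0 : c' l = 0) :
    ((stepSeries (φ l) (c' i) (c' l)).order.toNat) ^ 2 ≤ ((φ l).order.toNat) ^ 2 ∧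
      (φ l ≠ 0 → ((stepSeries (φ l) (c' i) (c' l)).order.toNat) ^ 2 < ((φ l).order.toNat) ^ 2) := by
  rw [h0]
  by_cases hφl : φ l = 0
  · rw [hφl, stepSeries_zero]
    exact ⟨le_rfl, fun h => absurd rfl h⟩
  · have hstep := order_stepSeries_add_one (hφ l hl) hφl hci
    -- finite orders: `ord φ_l = n + 1`, `ord step = n`
    have hfin : (φ l).order ≠ ⊤ := by rw [ne_eq, PowerSeries.order_eq_top]; exact hφl
    have hsfin : (stepSeries (φ l) (c' i) 0).order ≠ ⊤ := by
      intro h; rw [h, top_add] at hstep; exact hfin hstep.symm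
    obtain ⟨n, hn⟩ := ENat.ne_top_iff_exists.mp hsfin
    have hφn : (φ l).order = (n + 1 : ℕ) := by rw [← hstep, ← hn]; rfl
    rw [← hn, hφn, ENat.toNat_coe, ENat.toNat_coe]
    have hlt : n ^ 2 < (n + 1) ^ 2 := Nat.pow_lt_pow_left (Nat.lt_succ_self n) two_ne_zero
    exact ⟨hlt.le, fun _ => hlt⟩

open Classical in
/-- **THE CONTACT POTENTIAL DOES NOT GROW AT THE TANGENT ANSWER.** -/
theorem contactSq_step_le {i : Fin (m + 1)} {φ : Fin (m + 1) → PowerSeries k} (hφ : ∀ j, j ≠ i → PowerSeries.constantCoeff (φ j) = 0)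
    {c' : Fin (m + 1) → k} (hci : c' i ≠ 0) (E : Finset (Fin (m + 1))) :
    contactSq (insert 0 (Decoration.newLetters E (fun j => (X j : MvPowerSeries (Fin (m + 1)) k)) c' i)) 0 (step i φ c') ≤
      ∑ l ∈ (E.erase i).filter (fun l => c' l = 0), ((φ l).order.toNat) ^ 2 := by
  have h0 : (0 : Fin (m + 1)) ∉ Decoration.newLetters E (fun j => (X j : MvPowerSeries (Fin (m + 1)) k)) c' i :=
    Decoration.zero_notMem_newLetters E _ c' hci
  rw [contactSq, Finset.erase_insert h0, newLetters_X]
  -- the filter avoids `i` (`c′_i ≠ 0`), so the re-indexing is injective there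
  have hfi : ∀ l ∈ E.filter (fun l => c' l = 0), l ≠ i := fun l hl h => hci (h ▸ (Finset.mem_filter.mp hl).2)
  rw [Finset.sum_image (fun l₁ h₁ l₂ h₂ h => predAbove_succ_injective (hfi l₁ h₁) (hfi l₂ h₂) h)]
  have hsets : E.filter (fun l => c' l = 0) = (E.erase i).filter (fun l => c' l = 0) := by
    ext l
    simp only [Finset.mem_filter, Finset.mem_erase]
    exact ⟨fun ⟨hE, h0⟩ => ⟨⟨hfi l (Finset.mem_filter.mpr ⟨hE, h0⟩), hE⟩, h0⟩, fun ⟨⟨_, hE⟩, h0⟩ => ⟨hE, h0⟩⟩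
  rw [hsets]
  refine Finset.sum_le_sum fun l hl => ?_
  obtain ⟨hl', hl0⟩ := Finset.mem_filter.mp hl
  have hli : l ≠ i := Finset.ne_of_mem_erase hl'
  obtain ⟨p, hp⟩ := Fin.exists_succAbove_eq hli
  rw [← hp, TOT2Near.predAbove_succ_succAbove_succ, step_succ, hp]
  exact (contact_step_le hφ hci hli hl0).1

open Classical in
/-- **THE CONTACT POTENTIAL DROPS AT THE TANGENT ANSWER** unless every letter other than the graph letter already contains the curve. -/
theorem contactSq_step_lt {i : Fin (m + 1)} {φ : Fin (m + 1) → PowerSeries k} (hφ : ∀ j, j ≠ i → PowerSeries.constantCoeff (φ j) = 0)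
    {c' : Fin (m + 1) → k} (hc' : c' = c' i • tangent i φ) (hci : c' i ≠ 0) {E : Finset (Fin (m + 1))}
    (hnt : ∃ l ∈ E, l ≠ i ∧ φ l ≠ 0) :
    contactSq (insert 0 (Decoration.newLetters E (fun j => (X j : MvPowerSeries (Fin (m + 1)) k)) c' i)) 0 (step i φ c') <
      contactSq E i φ := by
  obtain ⟨l₀, hl₀E, hl₀i, hl₀φ⟩ := hnt
  have hl₀' : l₀ ∈ E.erase i := Finset.mem_erase.mpr ⟨hl₀i, hl₀E⟩
  by_cases h0 : c' l₀ = 0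
  · -- `l₀` passes through: its term drops strictly
    refine lt_of_lt_of_le ?_ (Finset.sum_le_sum_of_subset_of_nonneg (Finset.filter_subset (fun l => c' l = 0) (E.erase i))
      fun _ _ _ => Nat.zero_le _)
    have h0' : (0 : Fin (m + 1)) ∉ Decoration.newLetters E (fun j => (X j : MvPowerSeries (Fin (m + 1)) k)) c' i :=
      Decoration.zero_notMem_newLetters E _ c' hci
    rw [contactSq, Finset.erase_insert h0', newLetters_X]
    have hfi : ∀ l ∈ E.filter (fun l => c' l = 0), l ≠ i := fun l hl h => hci (h ▸ (Finset.mem_filter.mp hl).2)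
    rw [Finset.sum_image (fun l₁ h₁ l₂ h₂ h => predAbove_succ_injective (hfi l₁ h₁) (hfi l₂ h₂) h)]
    have hsets : E.filter (fun l => c' l = 0) = (E.erase i).filter (fun l => c' l = 0) := by
      ext l
      simp only [Finset.mem_filter, Finset.mem_erase]
      exact ⟨fun ⟨hE, h0⟩ => ⟨⟨hfi l (Finset.mem_filter.mpr ⟨hE, h0⟩), hE⟩, h0⟩, fun ⟨⟨_, hE⟩, h0⟩ => ⟨hE, h0⟩⟩
    rw [hsets]
    refine Finset.sum_lt_sum (fun l hl => ?_) ⟨l₀, Finset.mem_filter.mpr ⟨hl₀', h0⟩, ?_⟩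
    · obtain ⟨hl', hl0⟩ := Finset.mem_filter.mp hl
      have hli : l ≠ i := Finset.ne_of_mem_erase hl'
      obtain ⟨p, hp⟩ := Fin.exists_succAbove_eq hli
      rw [← hp, TOT2Near.predAbove_succ_succAbove_succ, step_succ, hp]
      exact (contact_step_le hφ hci hli hl0).1
    · obtain ⟨p, hp⟩ := Fin.exists_succAbove_eq hl₀i
      rw [← hp, TOT2Near.predAbove_succ_succAbove_succ, step_succ, hp]
      exact (contact_step_le hφ hci hl₀i h0).2 hl₀φ
  · -- `l₀` leaves: its (positive) term disappears
    refine lt_of_le_of_lt (contactSq_step_le hφ hci E) ?_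
    refine Finset.sum_lt_sum_of_subset (Finset.filter_subset _ _) hl₀' (fun h => h0 (Finset.mem_filter.mp h).2) ?_
      fun _ _ _ => Nat.zero_le _
    -- `ord φ_{l₀} = 1` exactly: positive square
    have h1 : PowerSeries.coeff 1 (φ l₀) ≠ 0 := by
      have h := answer_apply_of_eq_smul_tangent hc' l₀ hl₀i
      intro hz; rw [hz, mul_zero] at h; exact h0 h
    have hord : (φ l₀).order = 1 := by
      refine le_antisymm (PowerSeries.order_le 1 h1) ?_
      refine PowerSeries.le_order _ 1 fun j hj => ?_
      have hj0 : j = 0 := by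
        have : (j : ℕ∞) < 1 := hj
        exact Nat.lt_one_iff.mp (by exact_mod_cast this)
      rw [hj0, PowerSeries.coeff_zero_eq_constantCoeff, hφ l₀ hl₀i]
    rw [hord]
    decide

/-! ## Apex dimension ≤ 1 persists at a same-head answer -/

/-- **APEX DIMENSION ≤ 1 OF THE PRODUCT PERSISTS AT A SAME-HEAD ANSWER** of the identity point move (stub-3's (N2) with history, read through
`inv_mul_prod_X_iff` on both sides). -/
theorem apexLine_transform_of_head_eq [Infinite k] {b : MvPowerSeries (Fin (m + 1)) k} {δ : Decoration k m} (hadm : Admissible b δ)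
    (hcol : ∀ u₁ u₂ : Fin (m + 1) → k,
      (∀ v, CobordantChart.initEval (fun _ : Fin (m + 1) => 1) (v + u₁) δ.c (δ.f * ∏ l ∈ δ.O, X l) =
        CobordantChart.initEval (fun _ : Fin (m + 1) => 1) v δ.c (δ.f * ∏ l ∈ δ.O, X l)) →
      (∀ v, CobordantChart.initEval (fun _ : Fin (m + 1) => 1) (v + u₂) δ.c (δ.f * ∏ l ∈ δ.O, X l) =
        CobordantChart.initEval (fun _ : Fin (m + 1) => 1) v δ.c (δ.f * ∏ l ∈ δ.O, X l)) →
      ∃ α β : k, (α ≠ 0 ∨ β ≠ 0) ∧ α • u₁ + β • u₂ = 0)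
    {c' : Fin (m + 1) → k} {i' : Fin (m + 1)} (hci' : c' i' ≠ 0)
    (hhead : (δ.transform (fun j => (X j : MvPowerSeries (Fin (m + 1)) k)) (fun _ => 1) c' i').head = δ.head)
    {b' : MvPowerSeries (Fin (m + 1)) k} (hadm' : Admissible b' (δ.transform (fun j => (X j : MvPowerSeries (Fin (m + 1)) k)) (fun _ => 1) c' i')) :
    ∀ u₁ u₂ : Fin (m + 1) → k,
      (∀ v, CobordantChart.initEval (fun _ : Fin (m + 1) => 1) (v + u₁)
          (δ.transform (fun j => (X j : MvPowerSeries (Fin (m + 1)) k)) (fun _ => 1) c' i').c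
          ((δ.transform (fun j => (X j : MvPowerSeries (Fin (m + 1)) k)) (fun _ => 1) c' i').f *
            ∏ l ∈ (δ.transform (fun j => (X j : MvPowerSeries (Fin (m + 1)) k)) (fun _ => 1) c' i').O, X l) =
        CobordantChart.initEval (fun _ : Fin (m + 1) => 1) v
          (δ.transform (fun j => (X j : MvPowerSeries (Fin (m + 1)) k)) (fun _ => 1) c' i').c
          ((δ.transform (fun j => (X j : MvPowerSeries (Fin (m + 1)) k)) (fun _ => 1) c' i').f *
            ∏ l ∈ (δ.transform (fun j => (X j : MvPowerSeries (Fin (m + 1)) k)) (fun _ => 1) c' i').O, X l)) →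
      (∀ v, CobordantChart.initEval (fun _ : Fin (m + 1) => 1) (v + u₂)
          (δ.transform (fun j => (X j : MvPowerSeries (Fin (m + 1)) k)) (fun _ => 1) c' i').c
          ((δ.transform (fun j => (X j : MvPowerSeries (Fin (m + 1)) k)) (fun _ => 1) c' i').f *
            ∏ l ∈ (δ.transform (fun j => (X j : MvPowerSeries (Fin (m + 1)) k)) (fun _ => 1) c' i').O, X l) =
        CobordantChart.initEval (fun _ : Fin (m + 1) => 1) v
          (δ.transform (fun j => (X j : MvPowerSeries (Fin (m + 1)) k)) (fun _ => 1) c' i').c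
          ((δ.transform (fun j => (X j : MvPowerSeries (Fin (m + 1)) k)) (fun _ => 1) c' i').f *
            ∏ l ∈ (δ.transform (fun j => (X j : MvPowerSeries (Fin (m + 1)) k)) (fun _ => 1) c' i').O, X l)) →
      ∃ α β : k, (α ≠ 0 ∨ β ≠ 0) ∧ α • u₁ + β • u₂ = 0 := by
  set δ' := δ.transform (fun j => (X j : MvPowerSeries (Fin (m + 1)) k)) (fun _ => 1) c' i' with hδ'
  have hf : δ.f ≠ 0 := hadm.2.1.ne_zero
  have hpermX := isBPermissible_point_X δ
  have hconv : ∀ l, (fun _ : Fin (m + 1) => (1 : ℕ)) l = 0 → c' l = 0 := fun _ h => absurd h one_ne_zero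
  have hord : δ.f.order = (δ.o : ℕ∞) := order_f_eq_o hadm
  have hord' : δ'.f.order = (δ'.o : ℕ∞) := order_f_eq_o hadm'
  have hX : subst (fun j => (X j : MvPowerSeries (Fin (m + 1)) k)) δ.f = δ.f := congrFun subst_self _
  have heq : δ'.o = δ.o := o_transform_eq_of_head_eq hhead
  have hcard : δ'.O.card = δ.O.card := card_O_transform_eq_of_head_eq hhead
  -- `hcol` for `g` in the `O`-relative form for `f`
  have honeO : ∀ u₁ u₂ : Fin (m + 1) → k,
      (∀ v, CobordantChart.initEval (fun _ : Fin (m + 1) => 1) (v + u₁) δ.o (subst (fun j => (X j : MvPowerSeries (Fin (m + 1)) k)) δ.f) =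
        CobordantChart.initEval (fun _ : Fin (m + 1) => 1) v δ.o (subst (fun j => (X j : MvPowerSeries (Fin (m + 1)) k)) δ.f)) →
      (∀ l ∈ δ.O, u₁ (strIdx (fun j => (X j : MvPowerSeries (Fin (m + 1)) k)) l) = 0) →
      (∀ v, CobordantChart.initEval (fun _ : Fin (m + 1) => 1) (v + u₂) δ.o (subst (fun j => (X j : MvPowerSeries (Fin (m + 1)) k)) δ.f) =
        CobordantChart.initEval (fun _ : Fin (m + 1) => 1) v δ.o (subst (fun j => (X j : MvPowerSeries (Fin (m + 1)) k)) δ.f)) →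
      (∀ l ∈ δ.O, u₂ (strIdx (fun j => (X j : MvPowerSeries (Fin (m + 1)) k)) l) = 0) →
      ∃ α β : k, (α ≠ 0 ∨ β ≠ 0) ∧ α • u₁ + β • u₂ = 0 := by
    intro u₁ u₂ h₁ h₁O h₂ h₂O
    rw [hX] at h₁ h₂
    simp_rw [TOT2E1.strIdx_X] at h₁O h₂O
    exact hcol u₁ u₂ ((TOT2Near.inv_mul_prod_X_iff hord δ.O u₁).mpr ⟨h₁, h₁O⟩) ((TOT2Near.inv_mul_prod_X_iff hord δ.O u₂).mpr ⟨h₂, h₂O⟩)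
  intro w₁ w₂ hw₁ hw₂
  have hw₁' := (TOT2Near.inv_mul_prod_X_iff hord' δ'.O w₁).mp hw₁
  have hw₂' := (TOT2Near.inv_mul_prod_X_iff hord' δ'.O w₂).mp hw₂
  exact TOT2Near.Decoration.apexLineO_transform hpermX hconv hf hci' honeO heq hcard w₁ w₂ hw₁'.1 hw₁'.2 hw₂'.1 hw₂'.2
-- BODY-END

end GraphCurve

end TameFourTupleDrop

end Summit.ResolutionOfSingularities.ResolutionOfSingularities.Theorems

end
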